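import Mathlib
import Literature.Analysis.Complex.KthRootChart
import Literature.Geometry.Symplectic.JHolomorphicKthRootNormalForm
import Literature.Geometry.Symplectic.JAdaptedNormalFrameChart
import Literature.Geometry.Symplectic.JHolomorphicLeadingTermChart
import HarnessLib

/-!
# The `(zᵏ, û)` normal form in coordinates adapted to `J` along the tangent axis (Wendl 2020, §B.2.3)

Dimension four. Let `J` be a smooth almost complex structure on an open `U ⊆ F`
(`dim_ℝ F = 4`) and `u : B(z₀,R) → U` a smooth `J`-holomorphic curve, not locally constant at
`z₀`. The first half of the local representation formula (Wendl 2020, App. B, Thm B.23) was proved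
in `Literature/Geometry/Symplectic/JHolomorphicKthRootNormalForm.lean` with an AFFINE chart on the
target. For the second half (the expansion of `û(e^{2πiℓ/k} w) - û(w)`, (B.12)) the chart has to be
adapted to `J` along the tangent axis `ℂ × {0}` (Wendl 2020, §B.2.3, condition (3), in the weak
form `J(q,0)(0,w) = (0,iw)` provided by
`Literature/Geometry/Symplectic/JAdaptedNormalFrameChart.lean`). This file re-runs the normal
form in such a chart and keeps the first-order information that the proof provides:

* `BranchNormalForm.leadingTerm_comp_tangentId` — a leading term `zᵏ • v + O(|z|^{k+1})` (with
  `O(|z|ᵏ)` derivative remainder) survives composition with a smooth local diffeomorphism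
  tangent to the identity at `0` (Taylor);
* `BranchNormalForm.normalForm_of_chart_prod` — the `C¹` chart `ξ` and the function `û` with
  `Θ(u z) = (ξ(z)ᵏ, û(ξ z))` for a chart `Θ` into `ℂ × ℂ` in which `Θ ∘ u` has leading term
  `zᵏ • (1,0)`, INCLUDING `Dξ(z₀) = 𝟙`, a ball in `ξ.target` and Lemma B.29
  (`‖û w‖ ≤ C|w|^{k+1}`, `‖Dû w‖ ≤ C|w|ᵏ`);
* `BranchNormalForm.exists_adaptedChart` — the chart `Θ = Θ₁ ∘ A ∘ Φ ∘ (· - u z₀)` (linear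
  coordinates `Φ` with `Φ J(u z₀) = iΦ`, a complex-linear `A` turning the holomorphic leading
  coefficient into `(1,0)`, the normal-frame chart `Θ₁`), the transported structure `J₂` (smooth,
  `J₂² = -1`, `J₂(0) = i`, `J₂(q,0)(0,w) = (0,iw)` for `|q| < r`), `J₂`-holomorphicity of `Θ ∘ u`
  and its leading term `zᵏ • (1,0)`;
* `BranchNormalForm.exists_adaptedNormalForm` — all of the above assembled: the data
  `(k, Θ, J₂, ξ, û)` consumed by the rotation comparison (Wendl 2020, §B.2.4–B.2.5).

Everything is proved; no named facts.

## References

* C. Wendl, *Lectures on Contact 3-Manifolds, Holomorphic Curves and Intersection Theory*,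
  Cambridge Tracts in Math. 220 (2020), App. B, Thm B.23, §B.2.3 (conditions (1)–(3),
  Lemma B.29), Lemma B.32. [Wendl2020]
* M. Micallef, B. White, *The structure of branch points in minimal surfaces and in
  pseudoholomorphic curves*, Ann. of Math. 141 (1995), Thm 6.1. [MicallefWhite1995]
* D. McDuff, *The local behaviour of holomorphic curves in almost complex 4-manifolds*,
  J. Differential Geom. 34 (1991) 143–164, §2. [McDuff1991LocalBehaviour]
-/

noncomputable section

open scoped ContDiff Topology
open Set Filter Metric Function Complex Asymptotics

namespace Literature.Geometry.Symplectic

namespace BranchNormalForm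

open Literature.Analysis.Complex Literature.Analysis.Complex.KthRootChart

/-! ### A1. Leading terms survive a tangent-to-the-identity change of coordinates -/

/-- A `C²` map `G` with `G 0 = 0`, `DG(0) = 0` satisfies `‖DG(y)‖ ≤ K ‖y‖` and `‖G y‖ ≤ K ‖y‖²`
near `0`. [folklore] -/
theorem exists_quadratic_bound {G : ℂ × ℂ → ℂ × ℂ} {S : Set (ℂ × ℂ)} (hS : IsOpen S)
    (h0S : (0 : ℂ × ℂ) ∈ S) (hG : ContDiffOn ℝ ∞ G S) (hG0 : G 0 = 0)
    (hDG0 : fderiv ℝ G 0 = 0) :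
    ∃ (K δ : ℝ), 0 ≤ K ∧ 0 < δ ∧ closedBall (0 : ℂ × ℂ) δ ⊆ S ∧
      (∀ y ∈ closedBall (0 : ℂ × ℂ) δ, ‖fderiv ℝ G y‖ ≤ K * ‖y‖) ∧
      (∀ y ∈ closedBall (0 : ℂ × ℂ) δ, ‖G y‖ ≤ K * ‖y‖ ^ 2) := by
  obtain ⟨δ₀, hδ₀, hδ₀S⟩ := Metric.isOpen_iff.1 hS 0 h0S
  set δ : ℝ := δ₀ / 2 with hδ
  have hδpos : 0 < δ := by positivity
  have hKS : closedBall (0 : ℂ × ℂ) δ ⊆ S := (closedBall_subset_ball (by linarith)).trans hδ₀S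
  have hDG : ContDiffOn ℝ ∞ (fderiv ℝ G) S := hG.fderiv_of_isOpen hS (by simp)
  obtain ⟨K, hK⟩ := (hDG.mono hKS).exists_lipschitzOnWith (by simp) (convex_closedBall 0 δ)
    (isCompact_closedBall 0 δ)
  have h0K : (0 : ℂ × ℂ) ∈ closedBall (0 : ℂ × ℂ) δ := mem_closedBall_self hδpos.le
  have hD : ∀ y ∈ closedBall (0 : ℂ × ℂ) δ, ‖fderiv ℝ G y‖ ≤ K * ‖y‖ := by
    intro y hy
    have := hK.norm_sub_le hy h0K
    rwa [hDG0, sub_zero, sub_zero] at this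
  refine ⟨K, δ, K.coe_nonneg, hδpos, hKS, hD, fun y hy => ?_⟩
  -- mean value on the segment `[0, y]`
  have hdiff : ∀ x ∈ closedBall (0 : ℂ × ℂ) δ, DifferentiableAt ℝ G x := fun x hx =>
    (hG.differentiableOn (by simp)).differentiableAt (hS.mem_nhds (hKS hx))
  have hseg : ∀ x ∈ segment ℝ (0 : ℂ × ℂ) y, ‖fderiv ℝ G x‖ ≤ K * ‖y‖ := by
    intro x hx
    have hxK : x ∈ closedBall (0 : ℂ × ℂ) δ :=
      (convex_closedBall (0 : ℂ × ℂ) δ).segment_subset h0K hy hx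
    have hxy : ‖x‖ ≤ ‖y‖ := by
      obtain ⟨a, b, ha, hb, hab, rfl⟩ := hx
      simp only [smul_zero, zero_add, norm_smul, Real.norm_eq_abs, abs_of_nonneg hb]
      nlinarith [norm_nonneg y]
    exact (hD x hxK).trans (by gcongr)
  have := (convex_segment (0 : ℂ × ℂ) y).norm_image_sub_le_of_norm_fderiv_le (𝕜 := ℝ)
    (fun x hx => hdiff x ((convex_closedBall (0 : ℂ × ℂ) δ).segment_subset h0K hy hx)) hseg
    (left_mem_segment ℝ 0 y) (right_mem_segment ℝ 0 y)
  rw [hG0, sub_zero, sub_zero] at this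
  calc ‖G y‖ ≤ K * ‖y‖ * ‖y‖ := this
    _ = K * ‖y‖ ^ 2 := by ring

/-- **Leading terms through a tangent-to-the-identity diffeomorphism.** If
`h(z) = zᵏ • v + R(z)` with `‖R(z)‖ ≤ C|z|^{k+1}`, `‖DR(z)‖ ≤ C|z|ᵏ` on a ball (`k ≥ 1`), and `Θ₁`
is smooth near `0` with `Θ₁ 0 = 0`, `DΘ₁(0) = 𝟙`, then `Θ₁ ∘ h` has the same leading term with
bounds of the same shape on a smaller ball. (Used to pass the leading term of a `J`-curve from
linear coordinates to the normal-frame chart of [Wendl2020, App. B, §B.2.3].) [folklore] -/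
theorem leadingTerm_comp_tangentId {h : ℂ → ℂ × ℂ} {Θ₁ : ℂ × ℂ → ℂ × ℂ} {S : Set (ℂ × ℂ)}
    (hS : IsOpen S) (h0S : (0 : ℂ × ℂ) ∈ S) (hΘ : ContDiffOn ℝ ∞ Θ₁ S) (hΘ0 : Θ₁ 0 = 0)
    (hDΘ0 : fderiv ℝ Θ₁ 0 = ContinuousLinearMap.id ℝ (ℂ × ℂ))
    {k : ℕ} (hk : 0 < k) {v : ℂ × ℂ} {C ρ : ℝ} (hρ : 0 < ρ)
    (hh : DifferentiableOn ℝ h (ball 0 ρ))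
    (hb1 : ∀ z ∈ ball (0 : ℂ) ρ, ‖h z - z ^ k • v‖ ≤ C * ‖z‖ ^ (k + 1))
    (hb2 : ∀ z ∈ ball (0 : ℂ) ρ, ‖fderiv ℝ (fun z => h z - z ^ k • v) z‖ ≤ C * ‖z‖ ^ k) :
    ∃ (ρ' C' : ℝ), 0 < ρ' ∧ ρ' ≤ ρ ∧ MapsTo h (ball 0 ρ') S ∧
      (∀ z ∈ ball (0 : ℂ) ρ', ‖Θ₁ (h z) - z ^ k • v‖ ≤ C' * ‖z‖ ^ (k + 1)) ∧
      (∀ z ∈ ball (0 : ℂ) ρ', ‖fderiv ℝ (fun z => Θ₁ (h z) - z ^ k • v) z‖ ≤ C' * ‖z‖ ^ k) := by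
  -- the quadratic remainder of `Θ₁`
  set G : ℂ × ℂ → ℂ × ℂ := fun y => Θ₁ y - y with hG_def
  have hG : ContDiffOn ℝ ∞ G S := hΘ.sub contDiffOn_id
  have hG0 : G 0 = 0 := by simp [hG_def, hΘ0]
  have hΘd0 : DifferentiableAt ℝ Θ₁ 0 :=
    (hΘ.differentiableOn (by simp)).differentiableAt (hS.mem_nhds h0S)
  have hDG0 : fderiv ℝ G 0 = 0 := by
    have : G = fun y => Θ₁ y - id y := rfl
    rw [this, fderiv_fun_sub hΘd0 differentiableAt_id, hDΘ0, fderiv_id]; exact sub_self _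
  obtain ⟨K, δ, hK, hδ, hKS, hDG, hGq⟩ := exists_quadratic_bound hS h0S hG hG0 hDG0
  -- constants (replace `C` by `C₀ = max C 0 ≥ 0`)
  set C₀ : ℝ := max C 0 with hC₀
  have hC0 : 0 ≤ C₀ := le_max_right _ _
  have hb1' : ∀ z ∈ ball (0 : ℂ) ρ, ‖h z - z ^ k • v‖ ≤ C₀ * ‖z‖ ^ (k + 1) := fun z hz =>
    (hb1 z hz).trans (by gcongr; exact le_max_left _ _)
  have hb2' : ∀ z ∈ ball (0 : ℂ) ρ, ‖fderiv ℝ (fun z => h z - z ^ k • v) z‖ ≤ C₀ * ‖z‖ ^ k :=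
    fun z hz => (hb2 z hz).trans (by gcongr; exact le_max_left _ _)
  set C₁ : ℝ := ‖v‖ + C₀ with hC₁
  have hC₁0 : 0 ≤ C₁ := by positivity
  have hpow_succ : ∀ z : ℂ, ‖z‖ ≤ 1 → ‖z‖ ^ (k + 1) ≤ ‖z‖ ^ k := fun z hz1 =>
    pow_le_pow_of_le_one (norm_nonneg _) hz1 (Nat.le_succ k)
  have hpow_pred : ∀ z : ℂ, ‖z‖ ≤ 1 → ‖z‖ ^ k ≤ ‖z‖ ^ (k - 1) := fun z hz1 =>
    pow_le_pow_of_le_one (norm_nonneg _) hz1 (Nat.sub_le k 1)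
  -- size of `h` and `Dh`
  have hsize : ∀ z ∈ ball (0 : ℂ) ρ, ‖z‖ ≤ 1 → ‖h z‖ ≤ C₁ * ‖z‖ ^ k := by
    intro z hz hz1
    have e : h z = z ^ k • v + (h z - z ^ k • v) := by abel
    calc ‖h z‖ = ‖z ^ k • v + (h z - z ^ k • v)‖ := by rw [← e]
      _ ≤ ‖z ^ k • v‖ + ‖h z - z ^ k • v‖ := norm_add_le _ _
      _ ≤ ‖z‖ ^ k * ‖v‖ + C₀ * ‖z‖ ^ (k + 1) := by
          rw [norm_smul, norm_pow]; exact add_le_add le_rfl (hb1' z hz)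
      _ ≤ ‖z‖ ^ k * ‖v‖ + C₀ * ‖z‖ ^ k :=
          add_le_add le_rfl (mul_le_mul_of_nonneg_left (hpow_succ z hz1) hC0)
      _ = C₁ * ‖z‖ ^ k := by rw [hC₁]; ring
  -- the derivative of the model term `z ↦ zᵏ • v`
  set D : ℂ → (ℂ →L[ℝ] ℂ × ℂ) := fun z =>
    ((ContinuousLinearMap.toSpanSingleton ℂ ((k : ℂ) * z ^ (k - 1))).restrictScalars ℝ).smulRight v
    with hD_def
  have hpowd : ∀ z : ℂ, HasFDerivAt (fun z : ℂ => z ^ k • v) (D z) z := fun z =>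
    ((hasDerivAt_pow k z).hasFDerivAt.restrictScalars ℝ).smul_const v
  have hnorm_powd : ∀ z : ℂ, ‖D z‖ ≤ k * ‖z‖ ^ (k - 1) * ‖v‖ := by
    intro z
    refine ContinuousLinearMap.opNorm_le_bound _ (by positivity) fun c => ?_
    have : D z c = (c * ((k : ℂ) * z ^ (k - 1))) • v := by
      simp [hD_def, ContinuousLinearMap.toSpanSingleton_apply, smul_eq_mul]
    rw [this, norm_smul, norm_mul, norm_mul, Complex.norm_natCast, norm_pow]
    nlinarith [norm_nonneg c, norm_nonneg v, pow_nonneg (norm_nonneg z) (k - 1)]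
  have hDsize : ∀ z ∈ ball (0 : ℂ) ρ, ‖z‖ ≤ 1 →
      ‖fderiv ℝ h z‖ ≤ (k * ‖v‖ + C₀) * ‖z‖ ^ (k - 1) := by
    intro z hz hz1
    have hd : DifferentiableAt ℝ h z := hh.differentiableAt (isOpen_ball.mem_nhds hz)
    have hsum : HasFDerivAt h (fderiv ℝ (fun z => h z - z ^ k • v) z + D z) z := by
      have h1 : HasFDerivAt (fun z => h z - z ^ k • v) (fderiv ℝ (fun z => h z - z ^ k • v) z) z :=
        (hd.sub (hpowd z).differentiableAt).hasFDerivAt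
      have h2 : HasFDerivAt (fun z => (h z - z ^ k • v) + z ^ k • v)
          (fderiv ℝ (fun z => h z - z ^ k • v) z + D z) z := h1.add (hpowd z)
      simpa using h2
    rw [hsum.fderiv]
    calc ‖fderiv ℝ (fun z => h z - z ^ k • v) z + D z‖
        ≤ ‖fderiv ℝ (fun z => h z - z ^ k • v) z‖ + ‖D z‖ := norm_add_le _ _
      _ ≤ C₀ * ‖z‖ ^ k + k * ‖z‖ ^ (k - 1) * ‖v‖ := add_le_add (hb2' z hz) (hnorm_powd z)
      _ ≤ C₀ * ‖z‖ ^ (k - 1) + k * ‖z‖ ^ (k - 1) * ‖v‖ :=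
          add_le_add (mul_le_mul_of_nonneg_left (hpow_pred z hz1) hC0) le_rfl
      _ = (k * ‖v‖ + C₀) * ‖z‖ ^ (k - 1) := by ring
  -- the radius: `‖z‖ ≤ 1`, `C₁ ‖z‖^k ≤ δ`
  obtain ⟨ρ', hρ', hρ'ρ, hρ'1, hρ'δ⟩ : ∃ ρ' : ℝ, 0 < ρ' ∧ ρ' ≤ ρ ∧ ρ' ≤ 1 ∧ C₁ * ρ' ≤ δ := by
    refine ⟨min (min ρ 1) (δ / (C₁ + 1)), ?_, ?_, ?_, ?_⟩
    · refine lt_min (lt_min hρ one_pos) (by positivity)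
    · exact (min_le_left _ _).trans (min_le_left _ _)
    · exact (min_le_left _ _).trans (min_le_right _ _)
    · calc C₁ * min (min ρ 1) (δ / (C₁ + 1)) ≤ C₁ * (δ / (C₁ + 1)) := by
            gcongr; exact min_le_right _ _
        _ ≤ (C₁ + 1) * (δ / (C₁ + 1)) := by gcongr; linarith
        _ = δ := by field_simp
  have hzfacts : ∀ z ∈ ball (0 : ℂ) ρ', z ∈ ball (0 : ℂ) ρ ∧ ‖z‖ ≤ 1 ∧ ‖z‖ ^ k ≤ ‖z‖ ∧
      h z ∈ closedBall (0 : ℂ × ℂ) δ ∧ ‖h z‖ ≤ C₁ * ‖z‖ ^ k := by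
    intro z hz
    have hz' : ‖z‖ < ρ' := by simpa using hz
    have hzρ : z ∈ ball (0 : ℂ) ρ := ball_subset_ball hρ'ρ hz
    have hz1 : ‖z‖ ≤ 1 := hz'.le.trans hρ'1
    have hzk : ‖z‖ ^ k ≤ ‖z‖ := by
      calc ‖z‖ ^ k ≤ ‖z‖ ^ 1 := pow_le_pow_of_le_one (norm_nonneg _) hz1 hk
        _ = ‖z‖ := pow_one _
    have hhz := hsize z hzρ hz1
    refine ⟨hzρ, hz1, hzk, ?_, hhz⟩
    rw [mem_closedBall, dist_zero_right]
    calc ‖h z‖ ≤ C₁ * ‖z‖ ^ k := hhz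
      _ ≤ C₁ * ‖z‖ := by gcongr
      _ ≤ C₁ * ρ' := by gcongr
      _ ≤ δ := hρ'δ
  set C' : ℝ := K * C₁ ^ 2 + C₀ + K * C₁ * (k * ‖v‖ + C₀) with hC'
  refine ⟨ρ', C', hρ', hρ'ρ, fun z hz => hKS (hzfacts z hz).2.2.2.1, ?_, ?_⟩
  · intro z hz
    obtain ⟨hzρ, hz1, hzk, hzK, hhz⟩ := hzfacts z hz
    have e : Θ₁ (h z) - z ^ k • v = G (h z) + (h z - z ^ k • v) := by simp [hG_def]
    rw [e]
    calc ‖G (h z) + (h z - z ^ k • v)‖ ≤ ‖G (h z)‖ + ‖h z - z ^ k • v‖ := norm_add_le _ _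
      _ ≤ K * ‖h z‖ ^ 2 + C₀ * ‖z‖ ^ (k + 1) := add_le_add (hGq _ hzK) (hb1' z hzρ)
      _ ≤ K * (C₁ * ‖z‖ ^ k) ^ 2 + C₀ * ‖z‖ ^ (k + 1) := by gcongr
      _ = K * C₁ ^ 2 * (‖z‖ ^ k * ‖z‖ ^ k) + C₀ * ‖z‖ ^ (k + 1) := by ring
      _ ≤ K * C₁ ^ 2 * (‖z‖ ^ k * ‖z‖) + C₀ * ‖z‖ ^ (k + 1) := by gcongr
      _ = (K * C₁ ^ 2 + C₀) * ‖z‖ ^ (k + 1) := by ring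
      _ ≤ C' * ‖z‖ ^ (k + 1) := by
          gcongr; rw [hC']
          have : 0 ≤ K * C₁ * (k * ‖v‖ + C₀) := by positivity
          linarith
  · intro z hz
    obtain ⟨hzρ, hz1, hzk, hzK, hhz⟩ := hzfacts z hz
    have hd : DifferentiableAt ℝ h z := hh.differentiableAt (isOpen_ball.mem_nhds hzρ)
    have hGd : DifferentiableAt ℝ G (h z) :=
      (hG.differentiableOn (by simp)).differentiableAt (hS.mem_nhds (hKS hzK))
    have e : (fun z => Θ₁ (h z) - z ^ k • v) = fun z => G (h z) + (h z - z ^ k • v) := by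
      funext z; simp [hG_def]
    have hcomp : HasFDerivAt (fun z => G (h z)) ((fderiv ℝ G (h z)).comp (fderiv ℝ h z)) z :=
      hGd.hasFDerivAt.comp z hd.hasFDerivAt
    have hrest : HasFDerivAt (fun z => h z - z ^ k • v) (fderiv ℝ (fun z => h z - z ^ k • v) z) z :=
      (hd.sub (hpowd z).differentiableAt).hasFDerivAt
    have hsum : HasFDerivAt (fun z => G (h z) + (h z - z ^ k • v))
        ((fderiv ℝ G (h z)).comp (fderiv ℝ h z) + fderiv ℝ (fun z => h z - z ^ k • v) z) z :=
      hcomp.add hrest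
    rw [e, hsum.fderiv]
    calc ‖(fderiv ℝ G (h z)).comp (fderiv ℝ h z) + fderiv ℝ (fun z => h z - z ^ k • v) z‖
        ≤ ‖(fderiv ℝ G (h z)).comp (fderiv ℝ h z)‖ + ‖fderiv ℝ (fun z => h z - z ^ k • v) z‖ :=
          norm_add_le _ _
      _ ≤ ‖fderiv ℝ G (h z)‖ * ‖fderiv ℝ h z‖ + C₀ * ‖z‖ ^ k :=
          add_le_add (ContinuousLinearMap.opNorm_comp_le _ _) (hb2' z hzρ)
      _ ≤ (K * ‖h z‖) * ((k * ‖v‖ + C₀) * ‖z‖ ^ (k - 1)) + C₀ * ‖z‖ ^ k := by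
          gcongr
          · exact hDG _ hzK
          · exact hDsize z hzρ hz1
      _ ≤ (K * (C₁ * ‖z‖ ^ k)) * ((k * ‖v‖ + C₀) * ‖z‖ ^ (k - 1)) + C₀ * ‖z‖ ^ k := by gcongr
      _ = K * C₁ * (k * ‖v‖ + C₀) * (‖z‖ ^ (k - 1) * ‖z‖ ^ k) + C₀ * ‖z‖ ^ k := by ring
      _ ≤ K * C₁ * (k * ‖v‖ + C₀) * (1 * ‖z‖ ^ k) + C₀ * ‖z‖ ^ k := by
          gcongr
          exact pow_le_one₀ (norm_nonneg _) hz1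
      _ = (K * C₁ * (k * ‖v‖ + C₀) + C₀) * ‖z‖ ^ k := by ring
      _ ≤ C' * ‖z‖ ^ k := by
          gcongr; rw [hC']
          have : 0 ≤ K * C₁ ^ 2 := by positivity
          linarith


/-! ### A2. The normal form from a chart into `ℂ × ℂ` with leading coefficient `(1, 0)` -/

/-- **Normal form from a chart, with first-order information.** Variant of
`Literature.Geometry.Symplectic.normalForm_of_chart` for a smooth chart `Θ : F → ℂ × ℂ` in which
the curve already has leading term `zᵏ • (1, 0)`: there are a `C¹` local homeomorphism `ξ` at `z₀`
(`C¹` inverse, `C^∞` off `z₀`, `ξ z₀ = 0`, `Dξ(z₀) = 𝟙`) and a `C¹` map `û` with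
`‖û w‖ ≤ C'|w|^{k+1}`, `‖Dû w‖ ≤ C'|w|ᵏ` and `Θ(u z) = (ξ(z)ᵏ, û(ξ z))` near `z₀`. Compared with
`normalForm_of_chart` we keep the derivative bound for `û` (Wendl's Lemma B.29), `Dξ(z₀) = 𝟙` and a
ball inside `ξ.target`, all supplied by `Literature.Analysis.Complex.KthRootChart.exists_kthRootChart`.
[cite: Wendl2020, App. B, Thm B.23 and §B.2.3 (Lemma B.29)] -/
theorem normalForm_of_chart_prod {F : Type*} [NormedAddCommGroup F] [NormedSpace ℝ F]
    {u : ℂ → F} {z₀ : ℂ} {ρ : ℝ} (hρ : 0 < ρ) (hu : ContDiffOn ℝ ∞ u (ball z₀ ρ))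
    (Θ : OpenPartialHomeomorph F (ℂ × ℂ))
    (hus : MapsTo u (ball z₀ ρ) Θ.source) (hΘ : ContDiffOn ℝ ∞ Θ Θ.source)
    {k : ℕ} (hk : 0 < k) {C : ℝ}
    (hb1 : ∀ z ∈ ball (0 : ℂ) ρ, ‖Θ (u (z₀ + z)) - z ^ k • ((1 : ℂ), (0 : ℂ))‖ ≤ C * ‖z‖ ^ (k + 1))
    (hb2 : ∀ z ∈ ball (0 : ℂ) ρ,
      ‖fderiv ℝ (fun z => Θ (u (z₀ + z)) - z ^ k • ((1 : ℂ), (0 : ℂ))) z‖ ≤ C * ‖z‖ ^ k) :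
    ∃ (ξ : OpenPartialHomeomorph ℂ ℂ) (uhat : ℂ → ℂ) (ρ' ρ₁ C' : ℝ),
      0 < ρ' ∧ ρ' ≤ ρ ∧ 0 < ρ₁ ∧ 0 ≤ C' ∧
      ball z₀ ρ' ⊆ ξ.source ∧ ball 0 ρ₁ ⊆ ξ.target ∧ ξ z₀ = 0 ∧
      fderiv ℝ ξ z₀ = ContinuousLinearMap.id ℝ ℂ ∧
      ContDiffOn ℝ 1 ξ ξ.source ∧ ContDiffOn ℝ 1 ξ.symm ξ.target ∧
      ContDiffOn ℝ ∞ ξ (ξ.source \ {z₀}) ∧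
      MapsTo ξ (ball z₀ ρ') (ball 0 ρ₁) ∧ ContDiffOn ℝ 1 uhat (ball 0 ρ₁) ∧
      (∀ w ∈ ball (0 : ℂ) ρ₁, ‖uhat w‖ ≤ C' * ‖w‖ ^ (k + 1)) ∧
      (∀ w ∈ ball (0 : ℂ) ρ₁, ‖fderiv ℝ uhat w‖ ≤ C' * ‖w‖ ^ k) ∧
      (∀ z ∈ ball z₀ ρ', Θ (u z) = ((ξ z) ^ k, uhat (ξ z))) := by
  -- the components of `Θ ∘ u ∘ (z₀ + ·)`
  set e₁ : ℂ × ℂ := ((1 : ℂ), (0 : ℂ)) with he₁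
  set g₁ : ℂ → ℂ := fun z => (Θ (u (z₀ + z))).1 with hg₁
  set g₂ : ℂ → ℂ := fun z => (Θ (u (z₀ + z))).2 with hg₂
  have hsm : ∀ z : ℂ, z ^ k • e₁ = ((z ^ k : ℂ), (0 : ℂ)) := fun z => by
    simp [he₁, Prod.smul_mk, smul_eq_mul]
  have hg₁R : ∀ z, g₁ z - z ^ k = (Θ (u (z₀ + z)) - z ^ k • e₁).1 := fun z => by
    simp only [hg₁, hsm, Prod.fst_sub]
  have hg₂R : ∀ z, g₂ z = (Θ (u (z₀ + z)) - z ^ k • e₁).2 := fun z => by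
    simp only [hg₂, hsm, Prod.snd_sub, sub_zero]
  -- smoothness on the ball
  have hball : ∀ {r : ℝ} {z : ℂ}, z ∈ ball (0 : ℂ) r → z₀ + z ∈ ball z₀ r := by
    intro r z hz; simpa [mem_ball, dist_eq_norm] using hz
  have hut : ContDiffOn ℝ ∞ (fun z : ℂ => u (z₀ + z)) (ball (0 : ℂ) ρ) :=
    hu.comp (contDiff_const.add contDiff_id).contDiffOn fun z hz => hball hz
  have hh : ContDiffOn ℝ ∞ (fun z => Θ (u (z₀ + z))) (ball (0 : ℂ) ρ) :=
    hΘ.comp hut fun z hz => hus (hball hz)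
  have hRm : ContDiffOn ℝ ∞ (fun z => Θ (u (z₀ + z)) - z ^ k • e₁) (ball (0 : ℂ) ρ) :=
    hh.sub ((contDiff_id.pow k).smul contDiff_const).contDiffOn
  have hg₁diff : ContDiffOn ℝ ∞ g₁ (ball (0 : ℂ) ρ) := contDiff_fst.comp_contDiffOn hh
  have hg₂diff : ContDiffOn ℝ ∞ g₂ (ball (0 : ℂ) ρ) := contDiff_snd.comp_contDiffOn hh
  -- the bounds for the `k`-th root chart
  set C₁ : ℝ := max C 0 with hC₁
  have hC₁0 : 0 ≤ C₁ := le_max_right _ _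
  have hRm1 : ∀ z ∈ ball (0 : ℂ) ρ, ‖Θ (u (z₀ + z)) - z ^ k • e₁‖ ≤ C₁ * ‖z‖ ^ (k + 1) :=
    fun z hz => (hb1 z hz).trans (by gcongr; exact le_max_left _ _)
  have hRm2 : ∀ z ∈ ball (0 : ℂ) ρ, ∀ (L : ℂ × ℂ →L[ℝ] ℂ), ‖L‖ ≤ 1 →
      ‖fderiv ℝ (fun z => L (Θ (u (z₀ + z)) - z ^ k • e₁)) z‖ ≤ C₁ * ‖z‖ ^ k := by
    intro z hz L hL
    have hd : DifferentiableAt ℝ (fun z => Θ (u (z₀ + z)) - z ^ k • e₁) z :=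
      (hRm.differentiableOn (by simp)).differentiableAt (isOpen_ball.mem_nhds hz)
    have : (fun z => L (Θ (u (z₀ + z)) - z ^ k • e₁)) = L ∘ fun z => Θ (u (z₀ + z)) - z ^ k • e₁ :=
      rfl
    rw [this, (L.hasFDerivAt.comp z hd.hasFDerivAt).fderiv]
    calc ‖L.comp (fderiv ℝ (fun z => Θ (u (z₀ + z)) - z ^ k • e₁) z)‖
        ≤ ‖L‖ * ‖fderiv ℝ (fun z => Θ (u (z₀ + z)) - z ^ k • e₁) z‖ :=
          ContinuousLinearMap.opNorm_comp_le _ _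
      _ ≤ 1 * (C₁ * ‖z‖ ^ k) := by
          gcongr
          exact (hb2 z hz).trans (by gcongr; exact le_max_left _ _)
      _ = C₁ * ‖z‖ ^ k := one_mul _
  have hR₁ : ∀ z ∈ ball (0 : ℂ) ρ, ‖g₁ z - z ^ k‖ ≤ C₁ * ‖z‖ ^ (k + 1) := fun z hz => by
    rw [hg₁R]; exact (norm_fst_le _).trans (hRm1 z hz)
  have hR₂ : ∀ z ∈ ball (0 : ℂ) ρ, ‖g₂ z‖ ≤ C₁ * ‖z‖ ^ (k + 1) := fun z hz => by
    rw [hg₂R]; exact (norm_snd_le _).trans (hRm1 z hz)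
  have hDR₁ : ∀ z ∈ ball (0 : ℂ) ρ, ‖fderiv ℝ (fun z => g₁ z - z ^ k) z‖ ≤ C₁ * ‖z‖ ^ k := by
    intro z hz
    have : (fun z => g₁ z - z ^ k) =
        fun z => (ContinuousLinearMap.fst ℝ ℂ ℂ) (Θ (u (z₀ + z)) - z ^ k • e₁) := by
      funext z; rw [hg₁R]; rfl
    rw [this]
    exact hRm2 z hz _ (ContinuousLinearMap.norm_fst_le ℝ ℂ ℂ)
  have hDR₂ : ∀ z ∈ ball (0 : ℂ) ρ, ‖fderiv ℝ g₂ z‖ ≤ C₁ * ‖z‖ ^ k := by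
    intro z hz
    have : g₂ = fun z => (ContinuousLinearMap.snd ℝ ℂ ℂ) (Θ (u (z₀ + z)) - z ^ k • e₁) := by
      funext z; rw [hg₂R]; rfl
    rw [this]
    exact hRm2 z hz _ (ContinuousLinearMap.norm_snd_le ℝ ℂ ℂ)
  -- the `k`-th root chart at `0`
  obtain ⟨ξ, ρξ, ρ₁, C', hρξ, hρ₁, hsrc, htgt, hξ0, hfd0, hξC1, hξsymmC1, hξsmooth, hmaps, hpow,
    huhatC1, huhat1, huhat2, hg₂uhat⟩ :=
    exists_kthRootChart (G := ℂ) hk.ne' hρ hC₁0 hg₁diff hg₂diff hR₁ hDR₁ hR₂ hDR₂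
  have hC'0 : 0 ≤ C' := by
    have h0 : (0 : ℂ) ∈ ball (0 : ℂ) ρ₁ := mem_ball_self hρ₁
    obtain ⟨w, hw, hw0⟩ : ∃ w ∈ ball (0 : ℂ) ρ₁, w ≠ 0 := by
      refine ⟨((ρ₁ / 2 : ℝ) : ℂ), ?_, ?_⟩
      · rw [mem_ball, dist_zero_right, Complex.norm_real, Real.norm_eq_abs,
          abs_of_pos (by positivity)]
        linarith
      · exact_mod_cast (by positivity : (ρ₁ / 2 : ℝ) ≠ 0)
    have h1 := (norm_nonneg _).trans (huhat1 w hw)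
    have h2 : 0 < ‖w‖ ^ (k + 1) := pow_pos (norm_pos_iff.2 hw0) _
    nlinarith
  -- translate to `z₀`
  set τ : ℂ ≃ₜ ℂ := Homeomorph.addRight (-z₀) with hτ
  set ξX : OpenPartialHomeomorph ℂ ℂ := τ.transOpenPartialHomeomorph ξ with hξX
  have hξX_apply : ∀ z, ξX z = ξ (z + -z₀) := fun z => rfl
  have hξX_coe : (ξX : ℂ → ℂ) = fun z => ξ (z + -z₀) := rfl
  have hξX_symm : ∀ w, ξX.symm w = ξ.symm w + z₀ := fun w => by
    show ξ.symm w + -(-z₀) = _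
    rw [neg_neg]
  have hξX_src : ∀ z, z ∈ ξX.source ↔ z + -z₀ ∈ ξ.source := fun z => Iff.rfl
  have hξX_tgt : ξX.target = ξ.target := rfl
  set ρ' : ℝ := min ρξ ρ with hρ'
  have hρ'0 : 0 < ρ' := lt_min hρξ hρ
  have hshift : ∀ {z : ℂ}, z ∈ ball z₀ ρ' →
      z + -z₀ ∈ ball (0 : ℂ) ρξ ∧ z + -z₀ ∈ ball (0 : ℂ) ρ := by
    intro z hz
    have : ‖z + -z₀‖ < ρ' := by simpa [mem_ball, dist_eq_norm, ← sub_eq_add_neg] using hz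
    exact ⟨by simpa using this.trans_le (min_le_left _ _),
      by simpa using this.trans_le (min_le_right _ _)⟩
  set uhat : ℂ → ℂ := g₂ ∘ ξ.symm with huhat
  refine ⟨ξX, uhat, ρ', ρ₁, C', hρ'0, min_le_right _ _, hρ₁, hC'0, ?_, ?_, ?_, ?_, ?_, ?_, ?_, ?_,
    huhatC1, huhat1, huhat2, ?_⟩
  · -- `ball z₀ ρ' ⊆ ξX.source`
    intro z hz; rw [hξX_src]; exact hsrc (hshift hz).1
  · -- `ball 0 ρ₁ ⊆ ξX.target`
    rw [hξX_tgt]; exact htgt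
  · -- `ξX z₀ = 0`
    rw [hξX_apply, add_neg_cancel, hξ0]
  · -- `DξX(z₀) = 𝟙`
    have h0src : (0 : ℂ) ∈ ξ.source := hsrc (mem_ball_self hρξ)
    have hd : DifferentiableAt ℝ ξ 0 :=
      (hξC1.differentiableOn one_ne_zero).differentiableAt (ξ.open_source.mem_nhds h0src)
    have hd' : DifferentiableAt ℝ ξ (z₀ + -z₀) := by rwa [add_neg_cancel]
    have hc : HasFDerivAt (fun z : ℂ => ξ (z + -z₀))
        ((fderiv ℝ ξ (z₀ + -z₀)).comp (ContinuousLinearMap.id ℝ ℂ)) z₀ :=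
      hd'.hasFDerivAt.comp z₀ ((hasFDerivAt_id z₀).add_const (-z₀))
    rw [hξX_coe, hc.fderiv, add_neg_cancel, hfd0, ContinuousLinearMap.id_comp]
  · -- `C¹`
    exact hξC1.comp (contDiff_id.add contDiff_const).contDiffOn fun z hz => hz
  · -- inverse `C¹`
    rw [hξX_tgt]
    have : (ξX.symm : ℂ → ℂ) = fun w => ξ.symm w + z₀ := funext hξX_symm
    rw [this]
    exact hξsymmC1.add contDiffOn_const
  · -- smooth off `z₀`
    refine hξsmooth.comp (contDiff_id.add contDiff_const).contDiffOn fun z hz => ⟨hz.1, ?_⟩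
    have hne : z ≠ z₀ := hz.2
    show z + -z₀ ∉ ({0} : Set ℂ)
    rw [mem_singleton_iff, add_neg_eq_zero]; exact hne
  · -- maps the ball into `ball 0 ρ₁`
    intro z hz; rw [hξX_apply]; exact hmaps (hshift hz).1
  · -- the normal form
    intro z hz
    obtain ⟨h1, h2⟩ := hshift hz
    have hz' : z₀ + (z + -z₀) = z := by ring
    rw [hξX_apply, Prod.ext_iff]
    refine ⟨?_, ?_⟩
    · show (Θ (u z)).1 = ξ (z + -z₀) ^ k
      rw [hpow _ h1]; simp only [hg₁, hz']
    · show (Θ (u z)).2 = uhat (ξ (z + -z₀))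
      rw [← hg₂uhat _ h1]; simp only [hg₂, hz']


/-! ### A3. The chart adapted to `J` along the tangent axis -/

/-- **Coordinates adapted to `J` along the tangent axis of a `J`-curve** (Wendl 2020, §B.2.3,
conditions (1)–(2) and the normal-frame part of (3)). Let `F` be a real normed space of
dimension `4`, `J` a smooth almost complex structure on an open `U ⊆ F`, and `u : B(z₀,R) → U`
a smooth `J`-holomorphic curve, not locally constant at `z₀`. Then there are `k ≥ 1` and a smooth
chart `Θ` of `F` about `u z₀` onto an open subset of `ℂ × ℂ` (smooth inverse, `Θ (u z₀) = 0`),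
carrying `J` to a smooth almost complex structure `J₂` on `Θ.target` (`J₂(Θ x) ∘ DΘ(x) =
DΘ(x) ∘ J(x)`) with `J₂(0) = i` and `J₂(q,0)(0,w) = (0,iw)` along the axis `|q| < r`, and such that
the smooth `J₂`-holomorphic curve `Θ ∘ u` has the leading term `zᵏ • (1,0)` at `z₀`:
`‖Θ(u(z₀+z)) - zᵏ • (1,0)‖ ≤ C|z|^{k+1}`, `‖D(Θ∘u(z₀+·) - (·)ᵏ • (1,0))(z)‖ ≤ C|z|ᵏ`.
Construction: linear coordinates carrying `J(u z₀)` to `i`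
(`exists_equiv_euclidean_of_complexStructure`), the holomorphic leading term
(`jHolomorphic_leadingTerm_chart`) rotated to `(1,0)` (`exists_equiv_prod_apply_eq`), then the
normal-frame chart of `Literature/Geometry/Symplectic/JAdaptedNormalFrameChart.lean`
(`NormalFrameChart.exists_normalFrameChart`), through which the leading term passes by
`leadingTerm_comp_tangentId`. [cite: Wendl2020, App. B, §B.2.3 and Lemma B.32] -/
theorem exists_adaptedChart (F : Type) [NormedAddCommGroup F] [NormedSpace ℝ F]
    [FiniteDimensional ℝ F] (hF : Module.finrank ℝ F = 4)
    (J : F → F →L[ℝ] F) (U : Set F) (hU : IsOpen U) (hJ : ContDiffOn ℝ ∞ J U)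
    (hJ2 : ∀ x ∈ U, ∀ v : F, J x (J x v) = -v)
    (u : ℂ → F) (z₀ : ℂ) (R : ℝ) (hR : 0 < R) (hu : ContDiffOn ℝ ∞ u (ball z₀ R))
    (huU : MapsTo u (ball z₀ R) U)
    (hhol : ∀ z ∈ ball z₀ R, ∀ α : ℂ, fderiv ℝ u z (Complex.I * α) = J (u z) (fderiv ℝ u z α))
    (hnc : ∃ᶠ z in 𝓝 z₀, u z ≠ u z₀) :
    ∃ (k : ℕ) (Θ : OpenPartialHomeomorph F (ℂ × ℂ)) (J₂ : ℂ × ℂ → ℂ × ℂ →L[ℝ] ℂ × ℂ)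
      (r C ρ : ℝ), 0 < k ∧ 0 < r ∧ 0 < ρ ∧ ρ ≤ R ∧
      u z₀ ∈ Θ.source ∧ Θ (u z₀) = 0 ∧ ContDiffOn ℝ ∞ Θ Θ.source ∧
        ContDiffOn ℝ ∞ Θ.symm Θ.target ∧ Θ.source ⊆ U ∧
      ContDiffOn ℝ ∞ J₂ Θ.target ∧ (∀ y ∈ Θ.target, ∀ v, J₂ y (J₂ y v) = -v) ∧
        (∀ v, J₂ 0 v = I • v) ∧
        (∀ x ∈ Θ.source, ∀ v, J₂ (Θ x) (fderiv ℝ Θ x v) = fderiv ℝ Θ x (J x v)) ∧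
        (∀ q : ℂ, ‖q‖ < r → ((q, (0 : ℂ)) : ℂ × ℂ) ∈ Θ.target ∧
          ∀ w : ℂ, J₂ (q, 0) (0, w) = (0, I * w)) ∧
      MapsTo u (ball z₀ ρ) Θ.source ∧
        (∀ z ∈ ball z₀ ρ, fderiv ℝ (Θ ∘ u) z I = J₂ (Θ (u z)) (fderiv ℝ (Θ ∘ u) z 1)) ∧
        (∀ z ∈ ball (0 : ℂ) ρ, ‖Θ (u (z₀ + z)) - z ^ k • ((1 : ℂ), (0 : ℂ))‖ ≤ C * ‖z‖ ^ (k + 1)) ∧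
        (∀ z ∈ ball (0 : ℂ) ρ,
          ‖fderiv ℝ (fun z => Θ (u (z₀ + z)) - z ^ k • ((1 : ℂ), (0 : ℂ))) z‖ ≤ C * ‖z‖ ^ k) := by
  haveI : CompleteSpace F := FiniteDimensional.complete ℝ F
  set p : F := u z₀ with hp
  have hpU : p ∈ U := huU (mem_ball_self hR)
  have hJ₀2 : ∀ v, J p (J p v) = -v := hJ2 p hpU
  obtain ⟨Φ, hΦJ⟩ := exists_equiv_euclidean_of_complexStructure (n := 2) (by rw [hF]) (J p) hJ₀2
  have hhol1 : ∀ z ∈ ball z₀ R, fderiv ℝ u z I = J (u z) (fderiv ℝ u z 1) := fun z hz => by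
    simpa using hhol z hz 1
  -- ### Step 0: the affine chart `Θ₀ x = Φ (x - p)` and the holomorphic leading term
  set σ : F ≃ₜ F := Homeomorph.addRight (-p) with hσ
  set Θ₀ : OpenPartialHomeomorph F (EuclideanSpace ℂ (Fin 2)) :=
    (σ.trans (Φ : F ≃ₜ EuclideanSpace ℂ (Fin 2))).toOpenPartialHomeomorph with hΘ₀
  have hΘ₀_apply : ∀ x, Θ₀ x = Φ (x + -p) := fun x => rfl
  have hΘ₀_src : Θ₀.source = univ := rfl
  have hΘ₀_symm : ∀ y, Θ₀.symm y = Φ.symm y + p := fun y => by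
    show Φ.symm y + -(-p) = _
    rw [neg_neg]
  have hΘ₀p : Θ₀ p = 0 := by rw [hΘ₀_apply, add_neg_cancel, map_zero]
  have hΘ₀smooth : ContDiffOn ℝ ∞ Θ₀ Θ₀.source := by
    have : (Θ₀ : F → EuclideanSpace ℂ (Fin 2)) = fun x => Φ (x + -p) := rfl
    rw [this]
    exact (Φ.contDiff.comp (contDiff_id.add contDiff_const)).contDiffOn
  have hΘ₀symm_smooth : ContDiffOn ℝ ∞ Θ₀.symm Θ₀.target := by
    have : (Θ₀.symm : EuclideanSpace ℂ (Fin 2) → F) = fun y => Φ.symm y + p := funext hΘ₀_symm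
    rw [this]
    exact (Φ.symm.contDiff.add contDiff_const).contDiffOn
  have hfdΘ₀ : fderiv ℝ Θ₀ p = (Φ : F →L[ℝ] EuclideanSpace ℂ (Fin 2)) := by
    have : (Θ₀ : F → EuclideanSpace ℂ (Fin 2)) = fun x => Φ (x + -p) := rfl
    rw [this]
    exact ((Φ : F →L[ℝ] EuclideanSpace ℂ (Fin 2)).hasFDerivAt.comp p
      ((hasFDerivAt_id p).add_const (-p))).fderiv
  have hlin : ∀ v, fderiv ℝ Θ₀ (u z₀) (J (u z₀) v) = I • fderiv ℝ Θ₀ (u z₀) v := by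
    intro v; rw [← hp, hfdΘ₀]; exact hΦJ v
  obtain ⟨k, b, C, ρ, hk, hb, hρ, hρR, hus, hb1, hb2⟩ :=
    jHolomorphic_leadingTerm_chart hU (hJ.of_le (by norm_cast)) hR hu huU hhol1 hnc Θ₀
      (by rw [hΘ₀_src]; exact mem_univ _) hΘ₀p hΘ₀smooth (hΘ₀symm_smooth.of_le (by norm_cast)) hlin
  obtain ⟨A, hA⟩ := exists_equiv_prod_apply_eq hb
  -- ### the linear coordinates `M = A ∘ Φ` and the affine chart `e x = M (x - p)`
  set Aℓ : EuclideanSpace ℂ (Fin 2) ≃L[ℝ] ℂ × ℂ :=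
    ((A : EuclideanSpace ℂ (Fin 2) ≃L[ℂ] ℂ × ℂ).toLinearEquiv.restrictScalars ℝ).toContinuousLinearEquiv
    with hAℓ
  have hAℓ_apply : ∀ x, Aℓ x = A x := fun x => rfl
  set M : F ≃L[ℝ] ℂ × ℂ := Φ.trans Aℓ with hM
  have hM_apply : ∀ x, M x = A (Φ x) := fun x => rfl
  have hMJ : ∀ v, M (J p v) = I • M v := by
    intro v
    rw [hM_apply, hM_apply, hΦJ, A.map_smul]
  set e : F ≃ₜ ℂ × ℂ := σ.trans (M : F ≃ₜ ℂ × ℂ) with he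
  have he_apply : ∀ x, e x = M (x + -p) := fun x => rfl
  have he_symm : ∀ y, e.symm y = M.symm y + p := fun y => by
    show M.symm y + -(-p) = _
    rw [neg_neg]
  have he_p : e p = 0 := by rw [he_apply, add_neg_cancel, map_zero]
  have he_smooth : ContDiff ℝ ∞ (e : F → ℂ × ℂ) := by
    have : (e : F → ℂ × ℂ) = fun x => M (x + -p) := rfl
    rw [this]; exact M.contDiff.comp (contDiff_id.add contDiff_const)
  have he_symm_smooth : ContDiff ℝ ∞ (e.symm : ℂ × ℂ → F) := by
    have : (e.symm : ℂ × ℂ → F) = fun y => M.symm y + p := funext he_symm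
    rw [this]; exact M.symm.contDiff.add contDiff_const
  have hfd_e : ∀ x, fderiv ℝ (e : F → ℂ × ℂ) x = (M : F →L[ℝ] ℂ × ℂ) := by
    intro x
    have : (e : F → ℂ × ℂ) = fun x => M (x + -p) := rfl
    rw [this]
    have h : HasFDerivAt (fun x : F => M (x + -p)) ((M : F →L[ℝ] ℂ × ℂ).comp (ContinuousLinearMap.id ℝ F)) x :=
      ((M : F →L[ℝ] ℂ × ℂ).hasFDerivAt.comp x ((hasFDerivAt_id x).add_const (-p)))
    rw [h.fderiv, ContinuousLinearMap.comp_id]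
  -- ### the transported structure `J₁ = M J M⁻¹` on `V = e(U)`
  set J₁ : ℂ × ℂ → ℂ × ℂ →L[ℝ] ℂ × ℂ := fun y =>
    (M : F →L[ℝ] ℂ × ℂ).comp ((J (e.symm y)).comp (M.symm : ℂ × ℂ →L[ℝ] F)) with hJ₁
  have hJ₁_apply : ∀ y v, J₁ y v = M (J (e.symm y) (M.symm v)) := fun y v => rfl
  set V : Set (ℂ × ℂ) := (e.symm : ℂ × ℂ → F) ⁻¹' U with hV
  have hVopen : IsOpen V := hU.preimage e.symm.continuous
  have h0V : (0 : ℂ × ℂ) ∈ V := by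
    show e.symm 0 ∈ U
    rw [← he_p, e.symm_apply_apply]; exact hpU
  have hJ₁smooth : ContDiffOn ℝ ∞ J₁ V := by
    have h1 : ContDiffOn ℝ ∞ (fun y => J (e.symm y)) V :=
      hJ.comp he_symm_smooth.contDiffOn fun y hy => hy
    exact contDiffOn_const.clm_comp (h1.clm_comp contDiffOn_const)
  have hJ₁2 : ∀ y ∈ V, ∀ v, J₁ y (J₁ y v) = -v := by
    intro y hy v
    rw [hJ₁_apply, hJ₁_apply, M.symm_apply_apply, hJ2 _ hy, map_neg, M.apply_symm_apply]
  have hJ₁0 : ∀ v, J₁ 0 v = I • v := by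
    intro v
    rw [hJ₁_apply, ← he_p, e.symm_apply_apply, hMJ, M.apply_symm_apply]
  have hJ₁00 : J₁ 0 (0, 1) = (0, I) := by
    rw [hJ₁0]; ext <;> simp
  -- ### Step 1: the normal-frame chart for `J₁`
  obtain ⟨Θ₁, r, hr, h0src, hΘ₁0, hΘ₁smooth, hΘ₁symm_smooth, hDΘ₁0, hsrcV, -, hJ₂smooth, hJ₂2,
    hJ₂int, haxis⟩ := NormalFrameChart.exists_normalFrameChart hVopen h0V hJ₁smooth hJ₁2 hJ₁00
  set J₂ := NormalFrameChart.pullback J₁ with hJ₂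
  -- ### Step 2: the composite chart `Θ = Θ₁ ∘ e`
  set Θ : OpenPartialHomeomorph F (ℂ × ℂ) := e.transOpenPartialHomeomorph Θ₁ with hΘ
  have hΘ_apply : ∀ x, Θ x = Θ₁ (e x) := fun x => rfl
  have hΘ_coe : (Θ : F → ℂ × ℂ) = Θ₁ ∘ e := rfl
  have hΘ_src : ∀ x, x ∈ Θ.source ↔ e x ∈ Θ₁.source := fun x => Iff.rfl
  have hΘ_tgt : Θ.target = Θ₁.target := rfl
  have hΘ_symm : (Θ.symm : ℂ × ℂ → F) = e.symm ∘ Θ₁.symm := rfl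
  have hpsrc : p ∈ Θ.source := by rw [hΘ_src, he_p]; exact h0src
  have hΘp : Θ p = 0 := by rw [hΘ_apply, he_p, hΘ₁0]
  have hΘsmooth : ContDiffOn ℝ ∞ Θ Θ.source := by
    rw [hΘ_coe]; exact hΘ₁smooth.comp he_smooth.contDiffOn fun x hx => hx
  have hΘsymm_smooth : ContDiffOn ℝ ∞ Θ.symm Θ.target := by
    rw [hΘ_symm, hΘ_tgt]
    exact he_symm_smooth.contDiffOn.comp hΘ₁symm_smooth fun y _ => mem_univ _
  have hΘsrcU : Θ.source ⊆ U := by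
    intro x hx
    have h1 : e x ∈ V := hsrcV ((hΘ_src x).1 hx)
    have : e.symm (e x) ∈ U := h1
    rwa [e.symm_apply_apply] at this
  have hfdΘ : ∀ x ∈ Θ.source, fderiv ℝ Θ x = (fderiv ℝ Θ₁ (e x)).comp (M : F →L[ℝ] ℂ × ℂ) := by
    intro x hx
    have hd₁ : DifferentiableAt ℝ Θ₁ (e x) :=
      (hΘ₁smooth.differentiableOn (by simp)).differentiableAt
        (Θ₁.open_source.mem_nhds ((hΘ_src x).1 hx))
    have hde : HasFDerivAt (e : F → ℂ × ℂ) (M : F →L[ℝ] ℂ × ℂ) x := by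
      rw [← hfd_e x]; exact (he_smooth.differentiable (by simp) x).hasFDerivAt
    rw [hΘ_coe, (hd₁.hasFDerivAt.comp x hde).fderiv]
  have hΘint : ∀ x ∈ Θ.source, ∀ v, J₂ (Θ x) (fderiv ℝ Θ x v) = fderiv ℝ Θ x (J x v) := by
    intro x hx v
    rw [hfdΘ x hx, ContinuousLinearMap.comp_apply, ContinuousLinearMap.comp_apply, hΘ_apply,
      hJ₂int _ ((hΘ_src x).1 hx), hJ₁_apply, e.symm_apply_apply]
    simp
  have hJ₂0 : ∀ v, J₂ 0 v = I • v := by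
    intro v
    have := hJ₂int 0 h0src v
    rw [hΘ₁0, hDΘ₁0, ContinuousLinearMap.id_apply, ContinuousLinearMap.id_apply, hJ₁0] at this
    exact this
  -- ### the leading term of `Θ ∘ u` through `Θ₁`
  set h : ℂ → ℂ × ℂ := fun z => e (u (z₀ + z)) with hh_def
  have hball : ∀ {r' : ℝ} {z : ℂ}, z ∈ ball (0 : ℂ) r' → z₀ + z ∈ ball z₀ r' := by
    intro r' z hz; simpa [mem_ball, dist_eq_norm] using hz
  have hh_eq : ∀ z, h z = A (Θ₀ (u (z₀ + z))) := fun z => rfl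
  have hhdiff : DifferentiableOn ℝ h (ball (0 : ℂ) ρ) := by
    have h1 : ContDiffOn ℝ ∞ (fun z : ℂ => u (z₀ + z)) (ball (0 : ℂ) ρ) :=
      (hu.mono (ball_subset_ball hρR)).comp (contDiff_const.add contDiff_id).contDiffOn
        fun z hz => hball hz
    exact (he_smooth.comp_contDiffOn h1).differentiableOn (by simp)
  set e₁ : ℂ × ℂ := ((1 : ℂ), (0 : ℂ)) with he₁
  set Aℝ : EuclideanSpace ℂ (Fin 2) →L[ℝ] ℂ × ℂ :=
    (A : EuclideanSpace ℂ (Fin 2) →L[ℂ] ℂ × ℂ).restrictScalars ℝ with hAℝ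
  have hsplit : ∀ z, h z - z ^ k • e₁ = Aℝ (Θ₀ (u (z₀ + z)) - z ^ k • b) := by
    intro z
    show A (Θ₀ (u (z₀ + z))) - z ^ k • e₁ = A (Θ₀ (u (z₀ + z)) - z ^ k • b)
    rw [map_sub, A.map_smul, hA]
  set C₁ : ℝ := ‖Aℝ‖ * max C 0 with hC₁
  have hhb1 : ∀ z ∈ ball (0 : ℂ) ρ, ‖h z - z ^ k • e₁‖ ≤ C₁ * ‖z‖ ^ (k + 1) := by
    intro z hz
    rw [hsplit]
    calc ‖Aℝ (Θ₀ (u (z₀ + z)) - z ^ k • b)‖ ≤ ‖Aℝ‖ * ‖Θ₀ (u (z₀ + z)) - z ^ k • b‖ :=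
          Aℝ.le_opNorm _
      _ ≤ ‖Aℝ‖ * (max C 0 * ‖z‖ ^ (k + 1)) := by
          gcongr; exact (hb1 z hz).trans (by gcongr; exact le_max_left _ _)
      _ = C₁ * ‖z‖ ^ (k + 1) := by rw [hC₁]; ring
  have hhb2 : ∀ z ∈ ball (0 : ℂ) ρ, ‖fderiv ℝ (fun z => h z - z ^ k • e₁) z‖ ≤ C₁ * ‖z‖ ^ k := by
    intro z hz
    have hfun : (fun z => h z - z ^ k • e₁) = Aℝ ∘ fun z => Θ₀ (u (z₀ + z)) - z ^ k • b :=
      funext hsplit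
    have hd : DifferentiableAt ℝ (fun z => Θ₀ (u (z₀ + z)) - z ^ k • b) z := by
      have h1 : ContDiffOn ℝ ∞ (fun z : ℂ => u (z₀ + z)) (ball (0 : ℂ) ρ) :=
        (hu.mono (ball_subset_ball hρR)).comp (contDiff_const.add contDiff_id).contDiffOn
          fun z hz => hball hz
      have h2 : ContDiffOn ℝ ∞ (fun z => Θ₀ (u (z₀ + z))) (ball (0 : ℂ) ρ) :=
        hΘ₀smooth.comp h1 fun z hz => hus (hball hz)
      have h3 : ContDiffOn ℝ ∞ (fun z => Θ₀ (u (z₀ + z)) - z ^ k • b) (ball (0 : ℂ) ρ) :=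
        h2.sub ((contDiff_id.pow k).smul contDiff_const).contDiffOn
      exact (h3.differentiableOn (by simp)).differentiableAt (isOpen_ball.mem_nhds hz)
    rw [hfun, (Aℝ.hasFDerivAt.comp z hd.hasFDerivAt).fderiv]
    calc ‖Aℝ.comp (fderiv ℝ (fun z => Θ₀ (u (z₀ + z)) - z ^ k • b) z)‖
        ≤ ‖Aℝ‖ * ‖fderiv ℝ (fun z => Θ₀ (u (z₀ + z)) - z ^ k • b) z‖ :=
          ContinuousLinearMap.opNorm_comp_le _ _
      _ ≤ ‖Aℝ‖ * (max C 0 * ‖z‖ ^ k) := by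
          gcongr; exact (hb2 z hz).trans (by gcongr; exact le_max_left _ _)
      _ = C₁ * ‖z‖ ^ k := by rw [hC₁]; ring
  obtain ⟨ρ', C', hρ', hρ'ρ, hmaps, hgb1, hgb2⟩ :=
    leadingTerm_comp_tangentId Θ₁.open_source h0src hΘ₁smooth hΘ₁0 hDΘ₁0 hk hρ hhdiff hhb1 hhb2
  -- ### conclusion
  have husrc : MapsTo u (ball z₀ ρ') Θ.source := by
    intro z hz
    rw [hΘ_src]
    have hz' : z - z₀ ∈ ball (0 : ℂ) ρ' := by simpa [mem_ball, dist_eq_norm] using hz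
    have := hmaps hz'
    simpa [hh_def] using this
  refine ⟨k, Θ, J₂, r, C', ρ', hk, hr, hρ', hρ'ρ.trans hρR, hpsrc, hΘp, hΘsmooth, hΘsymm_smooth,
    hΘsrcU, hJ₂smooth, hJ₂2, hJ₂0, hΘint, haxis, husrc, ?_, ?_, ?_⟩
  · -- `Θ ∘ u` is `J₂`-holomorphic
    intro z hz
    have hzR : z ∈ ball z₀ R := ball_subset_ball (hρ'ρ.trans hρR) hz
    have hud : DifferentiableAt ℝ u z :=
      (hu.differentiableOn (by simp)).differentiableAt (isOpen_ball.mem_nhds hzR)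
    exact NormalFrameChart.jHolomorphic_transfer Θ.open_source (hΘsmooth.differentiableOn (by simp))
      hΘint hud (husrc hz) (hhol1 z hzR)
  · intro z hz; simpa [hΘ_apply, hh_def] using hgb1 z hz
  · intro z hz
    have : (fun z => Θ (u (z₀ + z)) - z ^ k • ((1 : ℂ), (0 : ℂ))) = fun z => Θ₁ (h z) - z ^ k • e₁ := by
      funext z; rfl
    rw [this]; exact hgb2 z hz


/-! ### A4. The normal form in adapted coordinates, with first-order data -/

/-- **The `(zᵏ, û)` normal form of a `J`-holomorphic curve in coordinates adapted to `J` along the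
tangent axis** (Wendl 2020, Thm B.23, first half, in the coordinates of §B.2.3). Everything of
`Literature.Geometry.Symplectic.jHolomorphic_kthRootNormalForm`, for the adapted chart of
`exists_adaptedChart`, together with the first-order information its proof provides and the
second half of Thm B.23 consumes: the transported structure `J₂` (smooth, `J₂² = -1`, `J₂(0) = i`,
standard on normal vectors along the axis), `J₂`-holomorphicity and the leading term
`zᵏ • (1,0)` of `Θ ∘ u`, `Dξ(z₀) = 𝟙`, a ball inside `ξ.target`, and Wendl's Lemma B.29
`‖û w‖ ≤ C|w|^{k+1}`, `‖Dû w‖ ≤ C|w|ᵏ`.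
[cite: Wendl2020, App. B, Thm B.23, §B.2.3 (Lemma B.29) and Lemma B.32] -/
theorem exists_adaptedNormalForm (F : Type) [NormedAddCommGroup F] [NormedSpace ℝ F]
    [FiniteDimensional ℝ F] (hF : Module.finrank ℝ F = 4)
    (J : F → F →L[ℝ] F) (U : Set F) (hU : IsOpen U) (hJ : ContDiffOn ℝ ∞ J U)
    (hJ2 : ∀ x ∈ U, ∀ v : F, J x (J x v) = -v)
    (u : ℂ → F) (z₀ : ℂ) (R : ℝ) (hR : 0 < R) (hu : ContDiffOn ℝ ∞ u (ball z₀ R))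
    (huU : MapsTo u (ball z₀ R) U)
    (hhol : ∀ z ∈ ball z₀ R, ∀ α : ℂ, fderiv ℝ u z (Complex.I * α) = J (u z) (fderiv ℝ u z α))
    (hnc : ∃ᶠ z in 𝓝 z₀, u z ≠ u z₀) :
    ∃ (k : ℕ) (Θ : OpenPartialHomeomorph F (ℂ × ℂ)) (J₂ : ℂ × ℂ → ℂ × ℂ →L[ℝ] ℂ × ℂ)
      (ξ : OpenPartialHomeomorph ℂ ℂ) (uhat : ℂ → ℂ) (r C ρ ρ₁ : ℝ),
      0 < k ∧ 0 < r ∧ 0 < ρ ∧ ρ ≤ R ∧ 0 < ρ₁ ∧ 0 ≤ C ∧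
      u z₀ ∈ Θ.source ∧ Θ (u z₀) = 0 ∧ ContDiffOn ℝ ∞ Θ Θ.source ∧
        ContDiffOn ℝ ∞ Θ.symm Θ.target ∧
      ContDiffOn ℝ ∞ J₂ Θ.target ∧ (∀ y ∈ Θ.target, ∀ v, J₂ y (J₂ y v) = -v) ∧
        (∀ v, J₂ 0 v = I • v) ∧
        (∀ q : ℂ, ‖q‖ < r → ((q, (0 : ℂ)) : ℂ × ℂ) ∈ Θ.target ∧
          ∀ w : ℂ, J₂ (q, 0) (0, w) = (0, I * w)) ∧
      MapsTo u (ball z₀ ρ) Θ.source ∧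
        (∀ z ∈ ball z₀ ρ, fderiv ℝ (Θ ∘ u) z I = J₂ (Θ (u z)) (fderiv ℝ (Θ ∘ u) z 1)) ∧
        (∀ z ∈ ball (0 : ℂ) ρ, ‖Θ (u (z₀ + z)) - z ^ k • ((1 : ℂ), (0 : ℂ))‖ ≤ C * ‖z‖ ^ (k + 1)) ∧
        (∀ z ∈ ball (0 : ℂ) ρ,
          ‖fderiv ℝ (fun z => Θ (u (z₀ + z)) - z ^ k • ((1 : ℂ), (0 : ℂ))) z‖ ≤ C * ‖z‖ ^ k) ∧
      ball z₀ ρ ⊆ ξ.source ∧ ball 0 ρ₁ ⊆ ξ.target ∧ ξ z₀ = 0 ∧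
        fderiv ℝ ξ z₀ = ContinuousLinearMap.id ℝ ℂ ∧
        ContDiffOn ℝ 1 ξ ξ.source ∧ ContDiffOn ℝ 1 ξ.symm ξ.target ∧
        ContDiffOn ℝ ∞ ξ (ξ.source \ {z₀}) ∧
        MapsTo ξ (ball z₀ ρ) (ball 0 ρ₁) ∧ ContDiffOn ℝ 1 uhat (ball 0 ρ₁) ∧
        (∀ w ∈ ball (0 : ℂ) ρ₁, ‖uhat w‖ ≤ C * ‖w‖ ^ (k + 1)) ∧
        (∀ w ∈ ball (0 : ℂ) ρ₁, ‖fderiv ℝ uhat w‖ ≤ C * ‖w‖ ^ k) ∧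
        (∀ z ∈ ball z₀ ρ, Θ (u z) = ((ξ z) ^ k, uhat (ξ z))) := by
  obtain ⟨k, Θ, J₂, r, C, ρ, hk, hr, hρ, hρR, hpsrc, hΘp, hΘsmooth, hΘsymm_smooth, -, hJ₂smooth,
    hJ₂2, hJ₂0, -, haxis, husrc, hghol, hb1, hb2⟩ :=
    exists_adaptedChart F hF J U hU hJ hJ2 u z₀ R hR hu huU hhol hnc
  obtain ⟨ξ, uhat, ρ', ρ₁, C', hρ', hρ'ρ, hρ₁, hC', hsrc, htgt, hξ0, hfd0, hξC1, hξsymmC1, hξsmooth,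
    hmaps, huhatC1, huhat1, huhat2, hnf⟩ :=
    normalForm_of_chart_prod hρ (hu.mono (ball_subset_ball hρR)) Θ husrc hΘsmooth hk hb1 hb2
  set C₀ : ℝ := max (max C 0) C' with hC₀
  have hCC₀ : C ≤ C₀ := (le_max_left _ _).trans (le_max_left _ _)
  have hC'C₀ : C' ≤ C₀ := le_max_right _ _
  have hC₀0 : 0 ≤ C₀ := (le_max_right _ _).trans (le_max_left _ _)
  refine ⟨k, Θ, J₂, ξ, uhat, r, C₀, ρ', ρ₁, hk, hr, hρ', hρ'ρ.trans hρR, hρ₁, hC₀0, hpsrc, hΘp,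
    hΘsmooth, hΘsymm_smooth, hJ₂smooth, hJ₂2, hJ₂0, haxis,
    fun z hz => husrc (ball_subset_ball hρ'ρ hz),
    fun z hz => hghol z (ball_subset_ball hρ'ρ hz), ?_, ?_, hsrc, htgt, hξ0, hfd0, hξC1, hξsymmC1,
    hξsmooth, hmaps, huhatC1, ?_, ?_, hnf⟩
  · exact fun z hz => (hb1 z (ball_subset_ball hρ'ρ hz)).trans (by gcongr)
  · exact fun z hz => (hb2 z (ball_subset_ball hρ'ρ hz)).trans (by gcongr)
  · exact fun w hw => (huhat1 w hw).trans (by gcongr)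
  · exact fun w hw => (huhat2 w hw).trans (by gcongr)

end BranchNormalForm

end Literature.Geometry.Symplectic

end
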